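import Summits.QuantumFields.YangMills.Theorems.BalabanUVNodesC44IterMhCone
import HarnessLib

/-!
# [B11] PROP. 4 AT THE RECORD (NODE-00) FROM THE KERNEL LETTERS — FREE-RADIUS EDITION: the Sect. C radii `ε_C = a_C := r′` may be ANY `0 < r′ ≤ r`, so the kernel-route window
# `2r′·Θ_H·(2d·g₀) ≤ ½` is met by SHRINKING `r′` (print's «it is valid if max{|A′|₍₋₁₎, |∇A′|₍₋₂₎} ≦ a₃», Prop. 4 p.293) instead of constraining the letters' constants

Cell `pub-ymgap` ∕ `ym-nodeO-ideate`, porter lineage `ymgap-nodeO-port-PTB-1` (gen 8); sequel of ✓`…Prop4ColumnsAtRecord` (G1) and ✓`…C44IterMhCone`.  `--kind proof --supports stmt-QuantumFields-27238 --as helper`;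
count-neutral.  [B11] = [Balaban1985Variational]; [B7] = [Balaban1985Averaging]; [B9] = [Balaban1985BackgroundPropagators].

WHY.  The doors F7∕F8∕G1∕Cone fix the radius at F6's `r = min(c₄∕4, ½, (16(bC₂+1))⁻¹)` (✓`prop4LetterNum_explicit`), so the window of lit's kernel route, `(ε_C + a_C)·Θ_H·G ≤ ½` with
`Θ_H ~ B·L^{kd}·K_d(δ)` ((KL-H)'s fine-column sum) and `G = 2d·g₀`, `g₀ ~ C₃η^d` ((KL-C) = [B7] (157)), reads `4rd·B·K_d·C₃ ≤ ½` — a constraint on the LETTERS' constants.  Print instead shrinks the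
radius («a₃»).  Here the scalar letter is proved for every `0 < r′ ≤ r` (`prop4LetterNum_of_le`; `0 < c₄` is implied) and the node-00 cone door is re-assembled at `ε_C = a_C = r′` directly over def-Y's
✓`prop4UniformAtRecord_of_letters_of_norm_J_le` — so a consumer picks `r′ ≤ min(r, (8d·Θ_H·g₀)⁻¹)` and the window holds.

WHAT THIS FILE PROVES (0 def):
* `prop4LetterNum_of_le` — `Prop4LetterNum b C₂ c₄ r′ r′ R_V (min r′ ((1 − 8bC₂r′)R_V))` for every `0 < r′ ≤ r`, `R_V > 0` (pure arithmetic).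
* ★★★ `prop4UniformAtRecord_node00_of_coneLetter_radius` — PROP. 4 (97)–(98) at the record in the node-00 regime (`0 < k ≤ m + K`, every site in `Ω_k`) at ANY radius `0 < r′ ≤ r`, from
  (ℓa-H) + (KL-H) + (KL-N) + the on-cone entry letter `g₀` of `D C^{𝔰𝔩}` on `‖A‖ < 2r′` + the window `2r′·Θ_H·(2d·g₀) ≤ ½` + print's (14) + `‖J‖ ≤ nJ`; constant = the numeric polynomial of
  ✓`prop4UniformAtRecord_of_recordLetters_numeric` at `(r′, R′ = min(r′, (1 − 8bC₂r′)∕16))` with `G := 2d·g₀`.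

HONEST FRAMING.  Glue (def-Y's door + F6 + F8 + G1 + Cone); NO estimate; (ℓa-H), (KL-H), (KL-N) ((R1)-class) and the entry letter `g₀` ([B7] Prop. 5 for the record's averaging) DISPLAYED,
unowned (★★★ №583); (ℓa-C) only for Ω_j = T; (R1)∕(R2) OPEN; K0ᴬ ⟨stmt-QuantumFields-27238⟩ NOT closed; K0ᴬ∕K1ᴬ∕K3ᴬ 0∕3; NODE O 0∕1; COUNT 8∕28 · K 1∕4 UNMOVED; finite `𝕋⁴_{L^K}` at fixed ε — NOT
continuum ∕ ℝ⁴ ∕ OS; **the Yang–Mills mass gap (Clay) is NOT proved by any of this.**  No `sorry`, `instance`, `notation`, `set_option`; standard axioms.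
-/

noncomputable section

open scoped Matrix Matrix.Norms.L2Operator InnerProductSpace ComplexConjugate BigOperators
open Classical

namespace Summit.QuantumFields.YangMills.Theorems.Prop4UniformAtRecord

open Literature.MathematicalPhysics.QuantumFieldTheory.Balaban1983to89
open Literature.MathematicalPhysics.QuantumFieldTheory.Balaban1983to89.Node00
open T4Continuum BlockAveraging
open B10Eq42TorusConstraint (bondsIn)
open B9SectCLatticeCarrier (Bond)
open B11Eq103H1Complex (SiteL2K)
open B11Eq115Space (NegSup NegSize levWeight)
open B11Eq90Transpose (single115)
open B11Eq90V0primeCurrent (flat115)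
open B11Eq111FrakG (nabla115)
open Summit.QuantumFields.YangMills.Theorems.C44IterMh (prop4LetterCAtRecord_of_regular loopProfile_of_regular_below kernelLetterC_of_cone
  norm_plaqHolU_unitsOfRecord_sub_one_le_of_plaqSmall plaqSmall_base_of_hreg levWeight_bondLevLit_eq_one levWeight_pairLevLit_eq_one wSup_le_one_of_eq_one
  wInvSup_le_one_of_eq_one)

/-! ## §1  The scalar letter at any radius `0 < r′ ≤ r` -/

/-- **THE SECT. C SCALARS AT A SHRUNK RADIUS**: for `0 ≤ b, C₂`, `0 < R_V` and ANY `0 < r′ ≤ r = min(c₄∕4, ½, (16(bC₂+1))⁻¹)`: `Prop4LetterNum b C₂ c₄ r′ r′ R_V (min r′ ((1 − 4bC₂(r′+r′))R_V))`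
(`4r′ ≤ c₄`, `4bC₂r′ ≤ ¼`). [cite: Balaban1985Variational, (46) p.285, Prop. 3 p.289, (118)–(121) p.295, Prop. 4 p.293 («valid if max{…} ≦ a₃»)] -/
theorem prop4LetterNum_of_le {b C₂ c₄ RV r' : ℝ} (hb : 0 ≤ b) (hC₂ : 0 ≤ C₂) (hRV : 0 < RV) (hr'0 : 0 < r')
    (hr' : r' ≤ min (c₄ / 4) (min (1 / 2) (1 / (16 * (b * C₂ + 1))))) :
    Prop4LetterNum b C₂ c₄ r' r' RV (min r' ((1 - 4 * b * C₂ * (r' + r')) * RV)) := by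
  have h4 : r' ≤ c₄ / 4 := hr'.trans (min_le_left _ _)
  have h16 : r' ≤ 1 / (16 * (b * C₂ + 1)) := hr'.trans ((min_le_right _ _).trans (min_le_right _ _))
  have hbC : 0 ≤ b * C₂ := mul_nonneg hb hC₂
  have hK : 0 < 16 * (b * C₂ + 1) := by positivity
  have h16' : r' * (16 * (b * C₂ + 1)) ≤ 1 := by rwa [le_div_iff₀ hK] at h16
  have hbr : b * C₂ * r' ≤ 1 / 16 := by nlinarith
  have hcontr : 4 * b * C₂ * (r' + r') < 1 := by nlinarith
  have hself : b * C₂ * (r' + r') ^ 2 ≤ r' := by nlinarith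
  refine ⟨hb, hC₂, hr'0.le, by linarith, hself, hcontr, le_min hr'0.le (mul_nonneg (by linarith) hRV.le), min_le_left _ _, min_le_right _ _⟩

/-! ## §2  The node-00 cone door at a free radius -/

section Record

variable (F : T4Family) (N : ℕ) [NeZero N] (K k : ℕ) (Ω : ℕ → Set (Site (F.P K) 0)) (U₀ : GaugeField (F.P K) 0 (SU N))
variable [Fact (0 < (F.L : ℝ))] [Fact (0 < (F.P K).eta k)] [Fact (0 < c0Rec F K k)] [Fact (∀ c, 0 < wBRec F K k c)]

/-- ★★★ **[B11] PROP. 4 (97)–(98) AT THE RECORD IN THE NODE-00 REGIME, KERNEL ROUTE, FREE RADIUS** (`0 < k ≤ m + K`, every site in `Ω_k`, ANY `0 < r′ ≤ r`): from (ℓa-H), (KL-H) (one-block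
letter of the record's `H₁(U₀)`), (KL-N) (one-block letter of `Δπ∘H₁(U₀)`), the ON-CONE ENTRY LETTER `‖(D C^{𝔰𝔩}(A)·δ_b X)(c)‖ ≤ g₀‖A‖‖X‖` (`b` in the two-block cone of `c`, `‖A‖ < 2r′`;
[B7] (157)'s shape), the window `2r′·Θ_H·(2d·g₀) ≤ ½`, print's (14) below `k` and `‖J‖ ≤ nJ`: `Prop4UniformAtRecord … r′ Gp C₄ R′` with `R′ = min(r′, (1 − 8bC₂r′)∕16)` and `C₄` the numeric
polynomial (`G := 2d·g₀` inside lit's `θ_E = 2Θ_H^wGℓ`, `θ₃ = (2ℓ+1)Θ_H^wG∕r′`, `θ_E′ = 2Θ′Gℓ`, `ℓ = (1 − 8bC₂r′)⁻¹`).  def-Y's ✓`prop4UniformAtRecord_of_letters_of_norm_J_le` with (ℓa-C) := F6,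
numbers := §1, (ℓb) := ✓`prop4LetterV0AtRecord_of_window` (weights `1`, plaquettes via F8), (ℓc) := ✓`prop4LetterSymmAtRecord_holds`, (ℓd) := G1 ∘ Cone §2.  HONEST: glue; the four letters are
DISPLAYED. [cite: Balaban1985Variational, Prop. 4 (97)–(98) pp.292–293, (14) p.280, (44)–(46) p.285, (73) p.289, (86)–(89) p.291; Balaban1985Averaging, Proposition 5 (157) p.42; Balaban1985BackgroundPropagators, (3.132) p.422] -/
theorem prop4UniformAtRecord_node00_of_coneLetter_radius [DecidableEq (PBond (F.P K) k)] (levB : PBond (F.P K) k → ℕ) (a : ℝ)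
    (hpos : ∀ x, x ≠ 0 → 0 < RCLike.re ⟪x, laplaceAOfRecord F N k U₀ (QOfRecord F N k U₀) (QflatOfRecord F N k) a x⟫_ℂ)
    (hQ : Function.Surjective (QOfRecord F N k U₀))
    (Gp : SiteL2K ℂ (F.P K).d (fun _ => (F.P K).sitesPerDir 0) (c0Rec F K k) (WRec N) →ₗ[ℂ]
      SiteL2K ℂ (F.P K).d (fun _ => (F.P K).sitesPerDir 0) (c0Rec F K k) (WRec N))
    {b α nJ : ℝ} (hkpos : 0 < k) (hkm : k ≤ (F.P K).m + (F.P K).K) (hb : 0 ≤ b) (hΩ : ∀ x, x ∈ Ω k) (hα0 : 0 ≤ α) (hα : α * (11000000 * N) ≤ 1)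
    (hreg : ∀ j, j < k → PlaqSmall (α * ((F.L : ℝ) ^ j * (F.P K).eta k) ^ 2) (Averaging.iter (avOfRecord F N K) j U₀))
    (hH : Prop4LetterHAtRecord F N K k Ω U₀ levB a hpos hQ b)
    -- the radius
    {r' : ℝ} (hr'0 : 0 < r')
    (hr'le : letI C₂ : ℝ := 12800000000000000 * (F.L : ℝ) * N
      letI c₄ : ℝ := 1 / (200000000000 * (F.L : ℝ) * N)
      r' ≤ min (c₄ / 4) (min (1 / 2) (1 / (16 * (b * C₂ + 1)))))
    -- (KL-H)
    {hk : Bond (F.P K).d (fun _ => (F.P K).sitesPerDir 0) → PBond (F.P K) k → ℝ} (hk0 : ∀ b' y, 0 ≤ hk b' y)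
    (hHk : ∀ (y : PBond (F.P K) k) (Z : Matrix (Fin N) (Fin N) ℂ) (b' : Bond (F.P K).d (fun _ => (F.P K).sitesPerDir 0)),
      ‖flat115 (H1OfRecordAtBgFlat F N K k Ω U₀ levB a hpos hQ
          ((NegSup.equiv (levWeight (F.L : ℝ) ((F.P K).eta k) levB 0) (Matrix (Fin N) (Fin N) ℂ)).symm (Pi.single y Z))) b'‖ ≤ hk b' y * ‖Z‖)
    {ΘH : ℝ} (hΘH : 0 ≤ ΘH) (hH1 : ∀ y, ∑ b', hk b' y ≤ ΘH) {ΘHw : ℝ} (hΘHw : 0 ≤ ΘHw)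
    (hHw : ∀ (bb : Bond (F.P K).d (fun _ => (F.P K).sitesPerDir 0)) (y : PBond (F.P K) k),
      ∑ b', levWeight (F.L : ℝ) ((F.P K).eta k) (bondLevLit F Ω k) 3 bb / levWeight (F.L : ℝ) ((F.P K).eta k) (bondLevLit F Ω k) 3 b' * hk b' y ≤ ΘHw)
    -- the on-cone entry letter of `D C^{sl}` on `‖A‖ < 2r′`, and the window
    {g₀ : ℝ} (hg₀ : 0 ≤ g₀)
    (hg : ∀ A : Space115Lit F N K k Ω U₀, ‖A‖ < r' + r' → ∀ (bb : Bond (F.P K).d (fun _ => (F.P K).sitesPerDir 0)) (X : Matrix (Fin N) (Fin N) ℂ) (c : PBond (F.P K) k),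
      (bondToLit (F.P K) 0).symm bb ∈ bondsIn 0 {x : Site (F.P K) 0 | B14.Eq22Determines.blockIter k x = c.src ∨ B14.Eq22Determines.blockIter k x = c.tgt} →
      ‖NegSup.equiv (levWeight (F.L : ℝ) ((F.P K).eta k) levB 0) (Matrix (Fin N) (Fin N) ℂ)
        (fderiv ℂ (CslOfRecord F N K k Ω U₀ levB) A
          (single115 (lev₁ := pairLevLit F Ω k) (Dc := nabla115 ((F.P K).eta k) (unitsOfRecord F N U₀)) bb X)) c‖ ≤ g₀ * ‖A‖ * ‖X‖)
    (hq : (r' + r') * ΘH * (2 * ((F.P K).d : ℝ) * g₀) ≤ 1 / 2)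
    -- (KL-N)
    {hk' : Bond (F.P K).d (fun _ => (F.P K).sitesPerDir 0) → PBond (F.P K) k → ℝ} (hk'0 : ∀ b' y, 0 ≤ hk' b' y)
    (hNk : ∀ (y : PBond (F.P K) k) (Z : Matrix (Fin N) (Fin N) ℂ) (b' : Bond (F.P K).d (fun _ => (F.P K).sitesPerDir 0)),
      ‖NegSup.equiv (levWeight (F.L : ℝ) ((F.P K).eta k) (bondLevLit F Ω k) 3) (Matrix (Fin N) (Fin N) ℂ)
        (DeltaPiCurOfRecord F N K k Ω U₀ Gp (QflatOfRecord F N k) (H1OfRecordAtBgFlat F N K k Ω U₀ levB a hpos hQ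
          ((NegSup.equiv (levWeight (F.L : ℝ) ((F.P K).eta k) levB 0) (Matrix (Fin N) (Fin N) ℂ)).symm (Pi.single y Z)))) b'‖ ≤ hk' b' y * ‖Z‖)
    {Θ' : ℝ} (hΘ'0 : 0 ≤ Θ')
    (hΘ' : ∀ (bb : Bond (F.P K).d (fun _ => (F.P K).sitesPerDir 0)) (y : PBond (F.P K) k),
      ∑ b', levWeight (F.L : ℝ) ((F.P K).eta k) (bondLevLit F Ω k) 3 bb / levWeight (F.L : ℝ) ((F.P K).eta k) (bondLevLit F Ω k) 1 b' * hk' b' y ≤ Θ')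
    {N₁ : ℝ} (hN₁0 : 0 ≤ N₁)
    (hN₁ : ∀ b', ∑ y, levWeight (F.L : ℝ) ((F.P K).eta k) (bondLevLit F Ω k) 3 b' / levWeight (F.L : ℝ) ((F.P K).eta k) levB 0 y * hk' b' y ≤ N₁)
    (hJ : ‖JOfRecordAtBg F N K k Ω U₀‖ ≤ nJ) :
    letI C₂ : ℝ := 12800000000000000 * (F.L : ℝ) * N
    letI R' : ℝ := min r' ((1 - 4 * b * C₂ * (r' + r')) * (1 / 16))
    letI CV : ℝ := 1024 * (((F.P K).d - 1 : ℕ) : ℝ) * ((1 : ℝ) * 1) ^ 3 * N * (α * (1 : ℝ) ^ 2 + 1 / 16)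
        + (((F.P K).d - 1 : ℕ) : ℝ) * ((1 : ℝ) * 1) ^ 3 * (136 + 2 * ((1 : ℝ) * 1)) * N
    letI G : ℝ := 2 * ((F.P K).d : ℝ) * g₀
    letI θ₃ : ℝ := (2 * (1 / (1 - 4 * b * C₂ * (r' + r'))) + 1) * ΘHw * G / r'
    letI θE : ℝ := 2 * ΘHw * G * (1 / (1 - 4 * b * C₂ * (r' + r')))
    letI θE' : ℝ := 2 * Θ' * G * (1 / (1 - 4 * b * C₂ * (r' + r')))
    Prop4UniformAtRecord F N K k Ω U₀ levB a hpos hQ r' Gp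
      ((N * θ₃ * nJ + (N₁ * C₂ * (1 / (1 - 4 * b * C₂ * (r' + r'))) ^ 2 + N * θE')
        + N * θE * (N₁ * C₂ * (1 / (1 - 4 * b * C₂ * (r' + r'))) ^ 2) * R'
        + N * (1 + θE * R') * CV * (1 / (1 - 4 * b * C₂ * (r' + r'))) ^ 2)) R' := by
  have hLN : (0 : ℝ) < (F.L : ℝ) * N := mul_pos Fact.out (by exact_mod_cast Nat.pos_of_ne_zero (NeZero.ne N))
  have hC₂ : (0 : ℝ) ≤ 12800000000000000 * (F.L : ℝ) * N := by rw [mul_assoc]; positivity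
  have hnum := prop4LetterNum_of_le hb hC₂ (by norm_num : (0 : ℝ) < 1 / 16) hr'0 hr'le
  have hC := prop4LetterCAtRecord_of_regular F N k Ω U₀ levB hΩ hα0 hα hreg
  have hU₀ : SmallBelow (avOfRecord F N K) k U₀ := (loopProfile_of_regular_below F N k U₀ le_rfl hα0 hα hreg).1
  obtain ⟨hgC0, hCg, hG⟩ := kernelLetterC_of_cone F N K k Ω U₀ hkm levB hU₀ hg₀ hg
  have hG0 : 0 ≤ 2 * ((F.P K).d : ℝ) * g₀ := by positivity
  have hcol := prop4LetterColumnsAtRecord_of_kernelLetters F N K k Ω U₀ levB a hpos hQ Gp hH hC hnum hr'0 hk0 hHk hΘH hH1 hΘHw hHw hgC0 hCg hG0 hG hq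
    hk'0 hNk hΘ'0 hΘ' hN₁0 hN₁
  have hpl := norm_plaqHolU_unitsOfRecord_sub_one_le_of_plaqSmall F N U₀ (plaqSmall_base_of_hreg F N U₀ hkpos hreg)
  have hwb : ∀ i, levWeight (F.L : ℝ) ((F.P K).eta k) (bondLevLit F Ω k) 1 i = 1 := levWeight_bondLevLit_eq_one F k Ω hΩ
  have hwp : ∀ p, levWeight (F.L : ℝ) ((F.P K).eta k) (pairLevLit F Ω k) 2 p = 1 := levWeight_pairLevLit_eq_one F K k Ω hΩ
  have hV := prop4LetterV0AtRecord_of_window F N K k Ω U₀ hα0 hpl le_rfl le_rfl (wSup_le_one_of_eq_one _ hwb) (wInvSup_le_one_of_eq_one _ hwb)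
    (wInvSup_le_one_of_eq_one _ hwp)
  have hmain := prop4UniformAtRecord_of_letters_of_norm_J_le F N K k Ω U₀ levB a hpos hQ Gp hH hC hnum hV (prop4LetterSymmAtRecord_holds F N K k Ω U₀ Gp) hcol hJ
  obtain ⟨⟨hθ₃, hθE, hθE', hN₁'⟩, -⟩ := hcol
  exact prop4UniformAtRecord_mono F N K k Ω U₀ levB a hpos hQ _ Gp hmain
    (c4OfRecord_le_numeric N ((norm_nonneg _).trans hJ) hV.1 hnum.2.2.2.2.2.2.1 hθ₃ hθE hθE' hN₁' hC₂)

end Record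

end Summit.QuantumFields.YangMills.Theorems.Prop4UniformAtRecord

end
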